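/-
Copyright (c) 2026 the pub-hodgecm-mathlib formalisation cell (harness21).  Prover seat hodgecm-mathlib-F0P2-p11 (g2) (L1; LEAD F0P6-plan (g14) «(o1) KIND 1», memo
`CENSUS-K1-DealTable` (T4) ASSEMBLED), Track B «K2-LIT» ∕ hLiu418 #184♮, ROAD Φ, G5-b = Φ7-3 (R1-α)(b) + (T4): THE MIDDLE TERM OF A RANK-ONE FOURIER COEFFICIENT IS A
RANK-ONE WHITTAKER INTEGRAL OF THE DOUBLED LINE — ★ p861327 composed with the (T4) chain ★ p862584∕p862629∕p862662.  THEOREMS ONLY.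
-/
import Summits.HodgeConjecture.HodgeConjecture.Theorems.K2LiuRankOneMiddleTermCorner   -- ★ p861327 `exists_middle_cell_rankOne_eq_corner_integral`
import Summits.HodgeConjecture.HodgeConjecture.Theorems.K2LiuLineCornerChart           -- ★ p862662 `cornerLine_eq_blkD_lineChart` (+ ★ p862584)
import Summits.HodgeConjecture.HodgeConjecture.Theorems.K2LiuCornerLineWhittaker       -- ★ p862629 `cornerLine_integral_eq_whittakerDelta_line_levi`
import HarnessLib

/-!
# Crux `HLiu418`, ROAD Φ, (R1-α)(b) ∘ (T4): `MID_S(h) = C • whittakerDelta⁽ᴮ⁾ (nB_* μ) (S'₂₂) (f (blkD (1, ·) · Λĝ h)) 1` for a rank-one index `S = u ⊗ w`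

Cell `hodgecm-mathlib`, crux item hLiu418 = `stmt-HodgeConjecture-24832` (helper lane, count-neutral); squad K2 ∕ K2Liu, LEAD F0P6-plan (g14); prover F0P2-p11 (g2).
THEOREMS ONLY (no `def`, no `instance`, no notation, no named-fact hypothesis, no `sorry`).

★ p861327 `exists_middle_cell_rankOne_eq_corner_integral`: `MID_S(νN, β, f, h) = C • ∫ conj ψ_S(Λĝ⁻¹ n₂ t Λĝ) · f(w₀ · n₂ t · Λĝ h) dμ(t)` (`ĝ = γ[w]`, `n = 2`).  THIS FILE, under the
corner hypothesis `he : e (1, 0) = 1` (the `inl` enumeration is the twin over ★ p862771) and for ANY line chart `nB` of the doubled LINE `H(V₂)` (★ p862662 `exists_lineChart`;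
`nB_* μ` is a Haar measure ★ p862728) and ANY by-value re-indexing `hψ : ψ_S(Λĝ⁻¹ u Λĝ) = ψ_{S'}(u)` on `N_Δ(𝔸)` (★ `unipDeltaChar_conj_eq` + ★ `exists_rat_levi_blocks`):
**`exists_middle_cell_rankOne_eq_whittakerDelta_line`** — p861327's binders and ONE constant `C ∈ (0, ∞)` with
  `MID_S(νN, β, f, h) = C • whittakerDelta⁽ᴮ⁾ (nB_* μ) ((σ S' σ⁻¹)₂₂) (fun y => f (blkD (1, y) · (Λĝ · h))) 1`.
So the K1-b♮ letter `Ebc` of ★ p862409 is, on `{1 < re s}`, `(∫β)⁻¹ · C ·` a rank-ONE WHITTAKER COEFFICIENT at a HAAR carrier of a continuous Siegel section of `I_Δ⁽ᴮ⁾(s + ½)`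
(★ p862495) of the doubled line — the (K1b-W) input (KIND W at `n := 1`).
HONEST LABEL.  Count-neutral helper (by value: the line chart `nB` — inhabited ★ p862662 — and the re-indexing `hψ` — inhabited ★ `unipDeltaChar_conj_eq`); `HC_CM` is proved only
modulo the 7 printed citations (2 remaining named inputs: hLiu418 = `stmt-HodgeConjecture-24832`, h413 = `stmt-HodgeConjecture-24833`) until rung 0 closes.

## References
* [KudlaRallis1994] S. Kudla, S. Rallis, Ann. of Math. 140 (1994), §2 (2.10)–(2.12).
* [Shimura1997] G. Shimura, CBMS 93 (1997), §18.3–18.5, Thm. 18.14.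
* [MoeglinWaldspurger1995] C. Mœglin, J.-L. Waldspurger, CUP (1995), II.1.7.
* [Tan1999] V. Tan, Canad. J. Math. 51 (1999), §4.
-/

set_option autoImplicit false
set_option linter.dupNamespace false -- the mandated namespace repeats `HodgeConjecture.HodgeConjecture`

noncomputable section

open scoped Matrix ENNReal NNReal ComplexConjugate
open NumberField IsDedekindDomain MeasureTheory MeasureTheory.Measure Filter Set Function
open Literature.NumberTheory.Automorphic Literature.NumberTheory.Automorphic.UnitaryGroup Literature.NumberTheory.GaloisRepresentations
open Literature.NumberTheory.GelbartRogawski1991 Literature.NumberTheory.GelbartRogawski1991.GRConstruction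
open Literature.NumberTheory.GelbartRogawski1991.AdaptedBlocks
open Literature.NumberTheory.K2Lit.SiegelDoubled Literature.MeasureTheory.Group
open UnitaryDualPair

namespace Summit.HodgeConjecture.HodgeConjecture.Cruxes.HLiu418.K2LiuRankOneMiddleTermWhittakerLine

open K2LiuUnipotentCoveringWeight K2LiuSiegelUnipotentFourierDefs K2LiuSiegelUnipotentCharacters K2LiuSiegelEisensteinCoeffOrbitSum K2LiuSiegelBruhatMiddleCellDelta
  K2LiuSiegelRationalLeviDecomposition K2LiuSiegelMiddleCellSortedPattern K2LiuSiegelMiddleCellLeviCriterion K2LiuSiegelEisensteinCoeffOrbitCriterion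
  K2LiuRankOneUnfolding K2LiuRankOneOrbitTransport K2LiuRankOneMiddleOrbitSum K2LiuRankOneCornerOrbit K2LiuRankOneMiddleTermCorner
  K2LiuBlockDiagUnipotentChart K2LiuCornerLineChartTwo K2LiuCornerLineWhittaker K2LiuLineCornerChart

variable {L : Type} [Field L] [NumberField L] [IsCMField L]

variable {n₁ n₂ : ℕ} {e : Fin (1 + 1) × Fin 1 ≃ Fin 2} (eA : Fin 1 × Fin 1 ≃ Fin n₁) (eB : Fin 1 × Fin 1 ≃ Fin n₂)
  (dA : Fin 1 → L) (hdA : ∀ i, IsCMField.complexConj L (dA i) = dA i)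
  (dB : Fin 1 → L) (hdB : ∀ i, IsCMField.complexConj L (dB i) = dB i)
  {dV : Fin (1 + 1) → L} {hdV : ∀ i, IsCMField.complexConj L (dV i) = dV i}
  (hVA : ∀ i, dV (Fin.castAdd 1 i) = dA i) (hVB : ∀ j, dV (Fin.natAdd 1 j) = dB j)
  {dW : Fin 1 → L} {hdW : ∀ i, IsCMField.complexConj L (dW i) = dW i}
variable [MeasurableSpace (unipDelta L e dV hdV dW hdW)] [BorelSpace (unipDelta L e dV hdV dW hdW)]

variable {g₀ : UnitaryGroup.rationalPair (Fp L) L (IsCMField.complexConj L) (1 + 1) 1 (Matrix.diagonal dV) (Matrix.diagonal dW)}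
  (hg₀ : ((g₀ : GL (Fin (1 + 1) × Fin 1) L) : Matrix (Fin (1 + 1) × Fin 1) (Fin (1 + 1) × Fin 1) L) = Matrix.diagonal (fun k => 1 - 2 * (![0, 1] : Fin 2 → L) (e k)))
  (Λ : GL (Fin 2) (AdeleRing (𝓞 L) L) →* HA L e dV hdV dW hdW)
  (hΛ : ∀ g : GL (Fin 2) (AdeleRing (𝓞 L) L), blk L e dV hdV dW hdW (Λ g) =
    cayR (AdeleRing (𝓞 L) L) (Fin 2) * Matrix.fromBlocks (g : Matrix (Fin 2) (Fin 2) (AdeleRing (𝓞 L) L)) 0 0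
      (((gramR L e dV hdV dW hdW).map ((algebraMap L (AdeleRing (𝓞 L) L)).comp (algebraMap (Fp L) L)))⁻¹ *
        (((g⁻¹ : GL (Fin 2) (AdeleRing (𝓞 L) L)) : Matrix (Fin 2) (Fin 2) (AdeleRing (𝓞 L) L)).map
          (conjAdele (Fp L) L (IsCMField.complexConj L)))ᵀ *
        (gramR L e dV hdV dW hdW).map ((algebraMap L (AdeleRing (𝓞 L) L)).comp (algebraMap (Fp L) L))) *
      cayRinv (AdeleRing (𝓞 L) L) (Fin 2))
  (Γ₀ : Subgroup (unipDelta L e dV hdV dW hdW))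
  (hΓ₀ : ∀ u : unipDelta L e dV hdV dW hdW, u ∈ Γ₀ ↔ (u : HA L e dV hdV dW hdW) ∈ ratH L e dV hdV dW hdW ∧
    IsSiegelDelta L e dV hdV dW hdW (iotaGG L e dV hdV dW hdW (1, UnitaryGroup.rationalPairToAdelic (Fp L) L (IsCMField.complexConj L) (1 + 1) 1 (Matrix.diagonal dV) (Matrix.diagonal dW) g₀) * (u : HA L e dV hdV dW hdW) * (iotaGG L e dV hdV dW hdW (1, UnitaryGroup.rationalPairToAdelic (Fp L) L (IsCMField.complexConj L) (1 + 1) 1 (Matrix.diagonal dV) (Matrix.diagonal dW) g₀))⁻¹))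
  (wq : unipDeltaRat L e dV hdV dW hdW → ratH L e dV hdV dW hdW)
  (hwq : ∀ ν, ((wq ν : ratH L e dV hdV dW hdW) : HA L e dV hdV dW hdW) =
    weylDelta L e dV hdV dW hdW * ((ν : unipDelta L e dV hdV dW hdW) : HA L e dV hdV dW hdW))

include hwq hg₀ hΛ hΓ₀ in
/-- **(R1-α)(b) ∘ (T4): THE MIDDLE TERM OF A RANK-ONE FOURIER COEFFICIENT IS A RANK-ONE WHITTAKER INTEGRAL OF THE DOUBLED LINE.**  ★ p861327's binders (datum `n = 2` of
#41 at `N = 2`, `M = 1`; `w₀ = ι(1, g₀)`, `Λ∕hΛ`, `Γ₀` with a covering weight, big-cell representatives `wq`; `νN` Haar invariant under the rational Levi conjugations; `μ` an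
additive Haar measure on `𝔸_{L⁺}`), the corner hypothesis `he : e (1, 0) = 1` with the see-saw datum `dV = dA ‖ dB`, a continuous line chart `nB` of `H(V₂)` with coordinate
`(t⊗1)δ` (★ p862662), and inside, for each rank-one `S = u ⊗ w` and row section `γ`, a by-value re-indexing `hψ : ψ_S(Λĝ⁻¹ u Λĝ) = ψ_{S'}(u)` on `N_Δ(𝔸)` (`ĝ = γ[w]`):
THEN `MID_S(νN, β, f, h) = C • whittakerDelta⁽ᴮ⁾ (nB_* μ) ((σ S' σ⁻¹)₂₂) (fun y => f (blkD (1, y) · (Λĝ · h))) 1` with ONE `C ∈ (0, ∞)`.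
[cite: KudlaRallis1994, §2 (2.10)–(2.12)] [cite: Shimura1997, §18.3] [cite: MoeglinWaldspurger1995, II.1.7] [cite: Tan1999, §4] -/
theorem exists_middle_cell_rankOne_eq_whittakerDelta_line (hdV0 : ∀ i, dV i ≠ 0) (hdW0 : ∀ i, dW i ≠ 0) (he : e (1, 0) = 1)
    (νN : Measure (unipDelta L e dV hdV dW hdW)) [IsHaarMeasure νN]
    [MeasurableSpace (AdeleRing (𝓞 (Fp L)) (Fp L))] [BorelSpace (AdeleRing (𝓞 (Fp L)) (Fp L))]
    (μ : Measure (AdeleRing (𝓞 (Fp L)) (Fp L))) [μ.IsAddHaarMeasure]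
    [MeasurableSpace (unipDelta L eB dB hdB dW hdW)] [BorelSpace (unipDelta L eB dB hdB dW hdW)]
    (nB : AdeleRing (𝓞 (Fp L)) (Fp L) → unipDelta L eB dB hdB dW hdW) (hnBc : Continuous nB)
    (hnB : ∀ t, (blk L eB dB hdB dW hdW (nB t : HA L eB dB hdB dW hdW)).toBlocks₁₂ =
      Matrix.of fun _ _ => AdeleRing.baseChange (Fp L) L t * algebraMap L (AdeleRing (𝓞 L) L) (imagUnit L)) :
    ∃ C : ℝ≥0∞, C ≠ 0 ∧ C ≠ ∞ ∧
      ∀ {β₁ : unipDelta L e dV hdV dW hdW → ℝ≥0∞} (_ : IsCoveringWeight Γ₀ β₁)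
        {β : unipDelta L e dV hdV dW hdW → ℝ≥0∞} (_ : IsCoveringWeight (unipDeltaRat L e dV hdV dW hdW) β)
        {χ : HeckeCharacter L} {s : ℂ} {f : HA L e dV hdV dW hdW → ℂ} (_ : IsSiegelDeltaSection L e dV hdV dW hdW χ s f) (_ : Continuous f)
        (_ : ∀ g : GL (Fin 2) L, MeasurePreserving (fun u : unipDelta L e dV hdV dW hdW =>
          (⟨Λ (Matrix.GeneralLinearGroup.map (algebraMap L (AdeleRing (𝓞 L) L)) g) * (u : HA L e dV hdV dW hdW) *
              (Λ (Matrix.GeneralLinearGroup.map (algebraMap L (AdeleRing (𝓞 L) L)) g))⁻¹,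
            conj_levi_mem_unipDelta L e dV hdV dW hdW Λ hΛ _ u.2⟩ : unipDelta L e dV hdV dW hdW)) νN νN)
        {S : Matrix (Fin 2) (Fin 2) L}
        (_ : S ∈ skewMatrices ((IsCMField.complexConj L : L ≃ₐ[Fp L] L) : L →+* L) ((gramR L e dV hdV dW hdW).map (algebraMap (Fp L) L)))
        {u w : Fin 2 → L} (_ : S = Matrix.vecMulVec u w) (_ : u ≠ 0) (hw : w ≠ 0)
        (γ : Projectivization L (Fin 2 → L) → GL (Fin 2) L)
        (_ : ∀ p, Projectivization.mk L ((γ p : Matrix (Fin 2) (Fin 2) L) 1) (row_ne_zero (γ p) 1) = p)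
        (S' : Matrix (Fin 2) (Fin 2) L)
        (_ : ∀ v : HA L e dV hdV dW hdW, v ∈ unipDelta L e dV hdV dW hdW →
          unipDeltaChar L e dV hdV dW hdW S
              ((Λ (Matrix.GeneralLinearGroup.map (algebraMap L (AdeleRing (𝓞 L) L)) (γ (Projectivization.mk L w hw))))⁻¹ * v *
                Λ (Matrix.GeneralLinearGroup.map (algebraMap L (AdeleRing (𝓞 L) L)) (γ (Projectivization.mk L w hw)))) =
            unipDeltaChar L e dV hdV dW hdW S' v)
        (h : HA L e dV hdV dW hdW)
        (_ : ∫⁻ u, (∑' q : SiegelDeltaQuot L e dV hdV dW hdW,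
          ‖f ((((Quotient.out q : ratH L e dV hdV dW hdW) : HA L e dV hdV dW hdW)) * ((u : HA L e dV hdV dW hdW) * h))‖ₑ) * β u ∂νN ≠ ∞),
        ∫ u, (β u).toReal • (conj (unipDeltaChar L e dV hdV dW hdW S (u : HA L e dV hdV dW hdW) : ℂ) *
            (∑' q : ↥(({Quotient.mk (MulAction.orbitRel (siegelDeltaRat L e dV hdV dW hdW) (ratH L e dV hdV dW hdW)) 1} ∪
              Set.range (fun ν : unipDeltaRat L e dV hdV dW hdW =>
                (Quotient.mk (MulAction.orbitRel (siegelDeltaRat L e dV hdV dW hdW) (ratH L e dV hdV dW hdW)) (wq ν) :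
                  SiegelDeltaQuot L e dV hdV dW hdW)))ᶜ : Set (SiegelDeltaQuot L e dV hdV dW hdW)),
            f ((((Quotient.out (q : SiegelDeltaQuot L e dV hdV dW hdW) : ratH L e dV hdV dW hdW) : HA L e dV hdV dW hdW)) *
              ((u : HA L e dV hdV dW hdW) * h)))) ∂νN =
          C.toReal • whittakerDelta L eB dB hdB dW hdW (Measure.map nB μ)
            ((Matrix.reindex (idxSplit e eA eB) (idxSplit e eA eB) S').toBlocks₂₂)
            (fun y => f (blkD L e eA eB dA hdA dB hdB dV hdV hVA hVB dW hdW (1, y) *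
              (Λ (Matrix.GeneralLinearGroup.map (algebraMap L (AdeleRing (𝓞 L) L)) (γ (Projectivization.mk L w hw))) * h))) 1 := by
  obtain ⟨n₂, C, hC0, hCtop, -, -, hn₂mem, hn₂X, -, hmain⟩ :=
    exists_middle_cell_rankOne_eq_corner_integral (hg₀ := hg₀) (Λ := Λ) (hΛ := hΛ) (Γ₀ := Γ₀) (hΓ₀ := hΓ₀) (wq := wq) (hwq := hwq) hdV0 hdW0 νN μ
  have hn₂ := cornerLine_eq_blkD_lineChart L e eA eB dA hdA dB hdB dV hdV hVA hVB dW hdW he nB hnB n₂ hn₂mem hn₂X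
  refine ⟨C, hC0, hCtop, ?_⟩
  intro β₁ hβ₁ β hβ χ s f hf hfc hconj S hS u w hS1 hu hw γ hγ S' hψ h hH
  rw [hmain hβ₁ hβ hf hfc hconj hS hS1 hu hw γ hγ h hH,
    cornerLine_integral_eq_whittakerDelta_line_levi L e eA eB dA hdA dB hdB dV hdV hVA hVB dW hdW he hg₀ μ nB hnBc.measurable n₂ hn₂ S S' _ hψ hfc _]

end Summit.HodgeConjecture.HodgeConjecture.Cruxes.HLiu418.K2LiuRankOneMiddleTermWhittakerLine

end
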